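import Mathlib

/-!
# K2 cone — CERTIFICATE REDUCTION (planner ad-ideate-p4 g17 «control», F-p4g17-1; crux workfile on the dir of
stmt-AnomalousDissipation-19491, companion of `K2ConeCertificateDesign.md`)

The renewal cone of `K2ConeSketch.lean` §6 (`RenewalConeInvariant 8 ρ K₀`, memo `K2ConeInvariant.md` v1.2) quantifies over
four infinite directions: the lattice class `c = (α,β) ∈ [0,1)²`, the shell index of input and output pieces (`s, s' ∈ ℕ`),
the truncation `K ≥ K₀`, and the debris age `k ≥ 1`.  This file proves the finite-dimensional algebra that reduces the cone
check to FINITELY MANY certified numbers plus four analytic majorants (memo §5: E1 far rows, E2 emission, E3 truncation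
modulus, E4 age-uniform debris) and two class-continuum lemmas (C1 modulus, C2 inert-line limits):

* §1 `cone_of_core_tail` — a nonnegative entry family `M c i j` (output `i`, input `j`) satisfies the row-sum cone
  `∑_{j∈J} M c i j · ε j ≤ Λ · ε i` for EVERY finite truncation `J` and every class `c`, provided: the CORE block (pieces in a
  finite set `core`) satisfies the cone with `Λ₀ < Λ`; far columns emit into each core row a ROW BUDGET `Em i` (EMISSION,
  E2; sup-entry form `cone_of_core_tail_of_sup`); far rows are dominated by a separable majorant `u i · w j` (FAR ROWS, E1);
  and two scalar inequalities hold.  The far profile is the explicit `ε j = κ · u j`.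
* §2 `core_cone_of_net` — the class continuum: a cone certified on a `δ`-net of classes with an entrywise modulus `L i j`
  transfers to all classes.
* §3 `cone_mono_of_le` / `cone_of_truncation_modulus` — the truncation direction: a cone certified at `K₀` with slack for an
  entrywise truncation modulus holds for all `K ≥ K₀`.
* §4 `renewal_row_of_core_tail` — the same bookkeeping with an additive debris term `Dsum c i j` (the `∑_k ρ^{-k} D_k` of the
  renewal gauge), so that §1 applies verbatim to `M + Dsum`.
* §5 `geom_aux` / `geom_partial_le` / `renewal_partial_sums` — the debris-age direction: an AGE-UNIFORM bound `D k ≤ Dbar`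
  (E4) and the cone for the single matrix `M + Dbar/(ρ-1)` give the partial-sum clause of `RenewalConeInvariant` for every `n`
  (geometric series `∑_{k<n} ρ^{-(k+1)} ≤ 1/(ρ-1)`).

Everything here is abstract (index type `ι`, class type `C`), sorry-free, and instantiated in the memo §3 by NAME:
`M c (t',s') (t,s) :=` the transfer amplitude of `K2ConeSketch.Transfer` at class/truncation `c`, `core := {V,H} × {0,…,S₀-1}`,
`u (t',s') := C_{t'}·2^{-s'}`, `w (t,s) := 2^{s/2}` on far columns (1 on core columns), `Em i :=` the E2 row budget.
WHAT THIS IS NOT: no entry of the physical matrix is bounded here; this is the glue that turns (certified core numbers + E1–E4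
+ C1–C2) into the cone for all classes, shells, truncations and ages.
-/

open Finset BigOperators

namespace Summit.AnomalousDissipation.AnomalousDissipation.Cruxes.K1LocalisedCascade.K2Cert

variable {ι C : Type*} [DecidableEq ι]

/-! ## §1 Core + emission + separable far rows ⇒ the cone for every finite truncation -/

/-- **Core–tail reduction.**  Row-sum cone for all classes and all finite truncations from: a certified finite core cone
(`hcore`, constant `Λ₀`), a ROW BUDGET `Em i` for the emission of far columns into each core row (`hemit`; the sup-entry ×
far-mass form is the corollary `cone_of_core_tail_of_sup`), a separable majorant of far rows (`hfar`), the explicit far profile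
`ε j = κ u j` (`hprof`), a uniform bound `s` for the far sum `∑ w·u` (`hs`), the core sum `Wc` (`hWc`), and the two scalar
conditions `h1` (far rows) and `h2` (core rows). -/
theorem cone_of_core_tail (core : Finset ι) (M : C → ι → ι → ℝ) (ε u w Em : ι → ℝ)
    (Λ Λ₀ κ Wc s : ℝ)
    (hM : ∀ c i j, 0 ≤ M c i j) (hε : ∀ i, 0 ≤ ε i) (hu : ∀ i, 0 ≤ u i) (hw : ∀ j, 0 ≤ w j) (hκ : 0 ≤ κ)
    (hcore : ∀ c, ∀ i ∈ core, ∑ j ∈ core, M c i j * ε j ≤ Λ₀ * ε i)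
    (hemit : ∀ c, ∀ i ∈ core, ∀ J : Finset ι, ∑ j ∈ J.filter (· ∉ core), M c i j * ε j ≤ Em i)
    (hfar : ∀ c, ∀ i ∉ core, ∀ j, M c i j ≤ u i * w j)
    (hprof : ∀ j ∉ core, ε j = κ * u j)
    (hWc : ∑ j ∈ core, w j * ε j ≤ Wc)
    (hs : ∀ J : Finset ι, ∑ j ∈ J.filter (· ∉ core), w j * u j ≤ s)
    (h1 : Wc + κ * s ≤ Λ * κ)
    (h2 : ∀ i ∈ core, Λ₀ * ε i + Em i ≤ Λ * ε i) :
    ∀ c i (J : Finset ι), ∑ j ∈ J, M c i j * ε j ≤ Λ * ε i := by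
  intro c i J
  -- split the truncation into its core part and its far part
  have hsplit : ∑ j ∈ J, M c i j * ε j
      = ∑ j ∈ J.filter (· ∈ core), M c i j * ε j + ∑ j ∈ J.filter (· ∉ core), M c i j * ε j :=
    (Finset.sum_filter_add_sum_filter_not J (· ∈ core) _).symm
  rw [hsplit]
  by_cases hi : i ∈ core
  · -- core row: core part ≤ Λ₀ ε i (monotone in the index set, nonneg terms), far part ≤ U i · κ · u₁
    have hA : ∑ j ∈ J.filter (· ∈ core), M c i j * ε j ≤ Λ₀ * ε i := by
      refine le_trans ?_ (hcore c i hi)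
      apply Finset.sum_le_sum_of_subset_of_nonneg
      · intro j hj; exact (Finset.mem_filter.mp hj).2
      · intro j _ _; exact mul_nonneg (hM c i j) (hε j)
    have hB : ∑ j ∈ J.filter (· ∉ core), M c i j * ε j ≤ Em i := hemit c i hi J
    linarith [h2 i hi]
  · -- far row: every term ≤ u i · w j · ε j; core part ≤ u i · Wc, far part ≤ u i · κ · s; ε i = κ u i
    have hT : ∀ j, M c i j * ε j ≤ u i * (w j * ε j) := by
      intro j
      calc M c i j * ε j ≤ (u i * w j) * ε j := mul_le_mul_of_nonneg_right (hfar c i hi j) (hε j)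
        _ = u i * (w j * ε j) := by ring
    have hA : ∑ j ∈ J.filter (· ∈ core), M c i j * ε j ≤ u i * Wc := by
      calc ∑ j ∈ J.filter (· ∈ core), M c i j * ε j
          ≤ ∑ j ∈ J.filter (· ∈ core), u i * (w j * ε j) := Finset.sum_le_sum fun j _ => hT j
        _ = u i * ∑ j ∈ J.filter (· ∈ core), w j * ε j := by rw [Finset.mul_sum]
        _ ≤ u i * ∑ j ∈ core, w j * ε j := by
            apply mul_le_mul_of_nonneg_left _ (hu i)
            apply Finset.sum_le_sum_of_subset_of_nonneg
            · intro j hj; exact (Finset.mem_filter.mp hj).2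
            · intro j _ _; exact mul_nonneg (hw j) (hε j)
        _ ≤ u i * Wc := mul_le_mul_of_nonneg_left hWc (hu i)
    have hB : ∑ j ∈ J.filter (· ∉ core), M c i j * ε j ≤ u i * (κ * s) := by
      calc ∑ j ∈ J.filter (· ∉ core), M c i j * ε j
          ≤ ∑ j ∈ J.filter (· ∉ core), u i * (κ * (w j * u j)) := by
            apply Finset.sum_le_sum
            intro j hj
            have hj' : j ∉ core := (Finset.mem_filter.mp hj).2
            calc M c i j * ε j ≤ u i * (w j * ε j) := hT j
              _ = u i * (κ * (w j * u j)) := by rw [hprof j hj']; ring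
        _ = u i * (κ * ∑ j ∈ J.filter (· ∉ core), w j * u j) := by rw [Finset.mul_sum, Finset.mul_sum]
        _ ≤ u i * (κ * s) := mul_le_mul_of_nonneg_left (mul_le_mul_of_nonneg_left (hs J) hκ) (hu i)
    have hεi : ε i = κ * u i := hprof i hi
    have : u i * Wc + u i * (κ * s) ≤ Λ * ε i := by
      rw [hεi]
      have := mul_le_mul_of_nonneg_left h1 (hu i)
      nlinarith [this]
    linarith

/-- **Sup-entry form of the emission budget** (the cruder bookkeeping: `M c i j ≤ U i` for far `j` and `∑_far u ≤ u₁` give the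
row budget `Em i = U i · κ · u₁`).  Adequate for the V rows of the K2 matrix; for the H rows (fed by a BAND of far V columns) the
row-budget form of `cone_of_core_tail` is the one to use (memo §3). -/
theorem cone_of_core_tail_of_sup (core : Finset ι) (M : C → ι → ι → ℝ) (ε u w U : ι → ℝ)
    (Λ Λ₀ κ Wc s u₁ : ℝ)
    (hM : ∀ c i j, 0 ≤ M c i j) (hε : ∀ i, 0 ≤ ε i) (hu : ∀ i, 0 ≤ u i) (hw : ∀ j, 0 ≤ w j)
    (hU : ∀ i, 0 ≤ U i) (hκ : 0 ≤ κ)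
    (hcore : ∀ c, ∀ i ∈ core, ∑ j ∈ core, M c i j * ε j ≤ Λ₀ * ε i)
    (hemit : ∀ c, ∀ i ∈ core, ∀ j ∉ core, M c i j ≤ U i)
    (hfar : ∀ c, ∀ i ∉ core, ∀ j, M c i j ≤ u i * w j)
    (hprof : ∀ j ∉ core, ε j = κ * u j)
    (hWc : ∑ j ∈ core, w j * ε j ≤ Wc)
    (hs : ∀ J : Finset ι, ∑ j ∈ J.filter (· ∉ core), w j * u j ≤ s)
    (hu₁ : ∀ J : Finset ι, ∑ j ∈ J.filter (· ∉ core), u j ≤ u₁)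
    (h1 : Wc + κ * s ≤ Λ * κ)
    (h2 : ∀ i ∈ core, Λ₀ * ε i + U i * (κ * u₁) ≤ Λ * ε i) :
    ∀ c i (J : Finset ι), ∑ j ∈ J, M c i j * ε j ≤ Λ * ε i := by
  refine cone_of_core_tail core M ε u w (fun i => U i * (κ * u₁)) Λ Λ₀ κ Wc s hM hε hu hw hκ hcore ?_ hfar hprof
    hWc hs h1 h2
  intro c i hi J
  calc ∑ j ∈ J.filter (· ∉ core), M c i j * ε j
      ≤ ∑ j ∈ J.filter (· ∉ core), U i * (κ * u j) := by
        apply Finset.sum_le_sum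
        intro j hj
        have hj' : j ∉ core := (Finset.mem_filter.mp hj).2
        rw [hprof j hj']
        exact mul_le_mul_of_nonneg_right (hemit c i hi j hj') (mul_nonneg hκ (hu j))
    _ = U i * (κ * ∑ j ∈ J.filter (· ∉ core), u j) := by rw [Finset.mul_sum, Finset.mul_sum]
    _ ≤ U i * (κ * u₁) := mul_le_mul_of_nonneg_left (mul_le_mul_of_nonneg_left (hu₁ J) hκ) (hU i)

/-! ## §2 The class continuum: a δ-net with an entrywise modulus -/

omit [DecidableEq ι] in
/-- **Net transfer.**  If every class `c` is within `δ` of a net point `c₀` (in the sense of the entrywise modulus: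
`M c i j ≤ M c₀ i j + L i j · δ` on the core), and the net points satisfy the core cone with the modulus slack folded in,
then every class satisfies the core cone. -/
theorem core_cone_of_net (core : Finset ι) (net : Set C) (M : C → ι → ι → ℝ) (L : ι → ι → ℝ) (ε : ι → ℝ)
    (Λ₀ δ : ℝ) (hε : ∀ i, 0 ≤ ε i)
    (hnet : ∀ c, ∃ c₀ ∈ net, ∀ i ∈ core, ∀ j ∈ core, M c i j ≤ M c₀ i j + L i j * δ)
    (hcert : ∀ c₀ ∈ net, ∀ i ∈ core, ∑ j ∈ core, (M c₀ i j + L i j * δ) * ε j ≤ Λ₀ * ε i) :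
    ∀ c, ∀ i ∈ core, ∑ j ∈ core, M c i j * ε j ≤ Λ₀ * ε i := by
  intro c i hi
  obtain ⟨c₀, hc₀, hL⟩ := hnet c
  refine le_trans ?_ (hcert c₀ hc₀ i hi)
  apply Finset.sum_le_sum
  intro j hj
  exact mul_le_mul_of_nonneg_right (hL i hi j hj) (hε j)

/-! ## §3 The truncation direction -/

omit [DecidableEq ι] in
/-- Monotonicity of the row-sum cone in the entries. -/
theorem cone_mono_of_le (S : Finset ι) (M N : ι → ι → ℝ) (ε : ι → ℝ) (Λ : ℝ) (hε : ∀ i, 0 ≤ ε i)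
    (hle : ∀ i ∈ S, ∀ j ∈ S, M i j ≤ N i j) (hN : ∀ i ∈ S, ∑ j ∈ S, N i j * ε j ≤ Λ * ε i) :
    ∀ i ∈ S, ∑ j ∈ S, M i j * ε j ≤ Λ * ε i := by
  intro i hi
  refine le_trans ?_ (hN i hi)
  exact Finset.sum_le_sum fun j hj => mul_le_mul_of_nonneg_right (hle i hi j hj) (hε j)

omit [DecidableEq ι] in
/-- **Truncation transfer.**  If the entries at every truncation `K ≥ K₀` exceed those at `K₀` by at most the truncation
modulus `τ i j`, and the `K₀` entries satisfy the cone with that slack folded in, then the cone holds for all `K ≥ K₀`. -/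
theorem cone_of_truncation_modulus (S : Finset ι) (M : ℕ → ι → ι → ℝ) (τ : ι → ι → ℝ) (ε : ι → ℝ) (Λ : ℝ) (K₀ : ℕ)
    (hε : ∀ i, 0 ≤ ε i)
    (hτ : ∀ K, K₀ ≤ K → ∀ i ∈ S, ∀ j ∈ S, M K i j ≤ M K₀ i j + τ i j)
    (hcert : ∀ i ∈ S, ∑ j ∈ S, (M K₀ i j + τ i j) * ε j ≤ Λ * ε i) :
    ∀ K, K₀ ≤ K → ∀ i ∈ S, ∑ j ∈ S, M K i j * ε j ≤ Λ * ε i :=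
  fun K hK => cone_mono_of_le S (M K) (fun i j => M K₀ i j + τ i j) ε Λ hε (hτ K hK) hcert

/-! ## §4 Debris: the renewal term is just another nonnegative entry family -/

/-- **Renewal row.**  With the debris series folded into an additive nonnegative family `Dsum` (the `∑_{k≥1} ρ^{-k} D_k` of
`K2ConeSketch.renewal_gauge`), the hypotheses of §1 for `M + Dsum` give the renewal cone; this is the form the memo's
certificate table is organised in (core block of `M + Dsum`, emission of `M + Dsum`, far rows of `M + Dsum`). -/
theorem renewal_row_of_core_tail (core : Finset ι) (M Dsum : C → ι → ι → ℝ) (ε u w Em : ι → ℝ)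
    (Λ Λ₀ κ Wc s : ℝ)
    (hM : ∀ c i j, 0 ≤ M c i j) (hD : ∀ c i j, 0 ≤ Dsum c i j) (hε : ∀ i, 0 ≤ ε i) (hu : ∀ i, 0 ≤ u i)
    (hw : ∀ j, 0 ≤ w j) (hκ : 0 ≤ κ)
    (hcore : ∀ c, ∀ i ∈ core, ∑ j ∈ core, (M c i j + Dsum c i j) * ε j ≤ Λ₀ * ε i)
    (hemit : ∀ c, ∀ i ∈ core, ∀ J : Finset ι, ∑ j ∈ J.filter (· ∉ core), (M c i j + Dsum c i j) * ε j ≤ Em i)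
    (hfar : ∀ c, ∀ i ∉ core, ∀ j, M c i j + Dsum c i j ≤ u i * w j)
    (hprof : ∀ j ∉ core, ε j = κ * u j)
    (hWc : ∑ j ∈ core, w j * ε j ≤ Wc)
    (hs : ∀ J : Finset ι, ∑ j ∈ J.filter (· ∉ core), w j * u j ≤ s)
    (h1 : Wc + κ * s ≤ Λ * κ)
    (h2 : ∀ i ∈ core, Λ₀ * ε i + Em i ≤ Λ * ε i) :
    ∀ c i (J : Finset ι), ∑ j ∈ J, (M c i j + Dsum c i j) * ε j ≤ Λ * ε i :=
  cone_of_core_tail core (fun c i j => M c i j + Dsum c i j) ε u w Em Λ Λ₀ κ Wc s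
    (fun c i j => add_nonneg (hM c i j) (hD c i j)) hε hu hw hκ hcore hemit hfar hprof hWc hs h1 h2

/-! ## §5 From age-uniform debris bounds to the partial sums of `RenewalConeInvariant` -/

/-- Geometric bookkeeping: `(ρ-1) · ∑_{k<n} ρ^{-(k+1)} = 1 - ρ^{-n}`. -/
theorem geom_aux (ρ : ℝ) (hρ : ρ ≠ 0) (n : ℕ) :
    (ρ - 1) * ∑ k ∈ Finset.range n, (ρ ^ (k + 1))⁻¹ = 1 - (ρ ^ n)⁻¹ := by
  induction n with
  | zero => simp
  | succ n ih =>
    rw [Finset.sum_range_succ, mul_add, ih]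
    have h1 : ρ ^ (n + 1) ≠ 0 := pow_ne_zero _ hρ
    have h2 : ρ ^ n ≠ 0 := pow_ne_zero _ hρ
    field_simp
    ring

/-- `∑_{k<n} ρ^{-(k+1)} ≤ 1/(ρ-1)` for `ρ > 1`. -/
theorem geom_partial_le (ρ : ℝ) (hρ : 1 < ρ) (n : ℕ) :
    ∑ k ∈ Finset.range n, (ρ ^ (k + 1))⁻¹ ≤ 1 / (ρ - 1) := by
  have hρ0 : ρ ≠ 0 := by positivity
  have hpos : 0 < ρ - 1 := by linarith
  have h := geom_aux ρ hρ0 n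
  have hinv : 0 ≤ (ρ ^ n)⁻¹ := by positivity
  rw [le_div_iff₀ hpos]
  nlinarith [h, hinv]

omit [DecidableEq ι] in
/-- **Renewal partial sums from an age-uniform debris bound.**  If `D k i j ≤ Dbar i j` for every age `k ≥ 1` and the
class-free majorant `M + Dbar/(ρ-1)` satisfies the row-sum cone with rate `ρ > 1` on every finite truncation, then the
partial-sum inequality of `K2ConeSketch.RenewalConeInvariant` (last clause) holds for every truncation `S`, every number
of ages `n` and every row `i`.  (So the certificate table is: entries of `M`, entries of `Dbar`, one Perron check.) -/
theorem renewal_partial_sums (M : ι → ι → ℝ) (D : ℕ → ι → ι → ℝ) (Dbar : ι → ι → ℝ) (ε : ι → ℝ) (ρ : ℝ)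
    (hρ : 1 < ρ) (hD0 : ∀ k i j, 0 ≤ D k i j) (hDbar : ∀ k, 1 ≤ k → ∀ i j, D k i j ≤ Dbar i j)
    (hε : ∀ j, 0 ≤ ε j)
    (hcone : ∀ (S : Finset ι) (i : ι), ∑ j ∈ S, (M i j + Dbar i j / (ρ - 1)) * ε j ≤ ρ * ε i) :
    ∀ (S : Finset ι) (n : ℕ) (i : ι),
      (∑ j ∈ S, M i j * ε j) + (∑ k ∈ Finset.range n, (ρ ^ (k + 1))⁻¹ * ∑ j ∈ S, D (k + 1) i j * ε j)
        ≤ ρ * ε i := by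
  intro S n i
  have hpos : 0 < ρ - 1 := by linarith
  have hDb0 : ∀ j, 0 ≤ Dbar i j := fun j => le_trans (hD0 1 i j) (hDbar 1 le_rfl i j)
  -- each age: ∑_j D_{k+1} i j ε j ≤ ∑_j Dbar i j ε j
  have hage : ∀ k, ∑ j ∈ S, D (k + 1) i j * ε j ≤ ∑ j ∈ S, Dbar i j * ε j := fun k =>
    Finset.sum_le_sum fun j _ => mul_le_mul_of_nonneg_right (hDbar (k + 1) (Nat.le_add_left 1 k) i j) (hε j)
  have hB : ∑ k ∈ Finset.range n, (ρ ^ (k + 1))⁻¹ * ∑ j ∈ S, D (k + 1) i j * ε j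
      ≤ (1 / (ρ - 1)) * ∑ j ∈ S, Dbar i j * ε j := by
    calc ∑ k ∈ Finset.range n, (ρ ^ (k + 1))⁻¹ * ∑ j ∈ S, D (k + 1) i j * ε j
        ≤ ∑ k ∈ Finset.range n, (ρ ^ (k + 1))⁻¹ * ∑ j ∈ S, Dbar i j * ε j := by
          apply Finset.sum_le_sum; intro k _
          exact mul_le_mul_of_nonneg_left (hage k) (by positivity)
      _ = (∑ k ∈ Finset.range n, (ρ ^ (k + 1))⁻¹) * ∑ j ∈ S, Dbar i j * ε j := by rw [Finset.sum_mul]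
      _ ≤ (1 / (ρ - 1)) * ∑ j ∈ S, Dbar i j * ε j :=
          mul_le_mul_of_nonneg_right (geom_partial_le ρ hρ n)
            (Finset.sum_nonneg fun j _ => mul_nonneg (hDb0 j) (hε j))
  have hsum : ∑ j ∈ S, (M i j + Dbar i j / (ρ - 1)) * ε j
      = (∑ j ∈ S, M i j * ε j) + (1 / (ρ - 1)) * ∑ j ∈ S, Dbar i j * ε j := by
    rw [Finset.mul_sum, ← Finset.sum_add_distrib]
    apply Finset.sum_congr rfl; intro j _; ring
  linarith [hcone S i, hB, hsum]

end Summit.AnomalousDissipation.AnomalousDissipation.Cruxes.K1LocalisedCascade.K2Cert
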